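import Summits.Langlands.Langlands.Theses.MonodromyDichotomy

/-!
# Glue of the lens-2-g4 resplit of `LieIrreducibleAutomorphy` (route MonodromyDichotomy) — filing K1

Target `Summits/Langlands/Langlands/Theorems/MonodromyDichotomyLieIrreducibleAutomorphyOfResplit.lean`, to be proposed
AFTER `ledger route edit route-Langlands-MonodromyDichotomy --resplit LieIrreducibleAutomorphy --into …children.json
--glue '…' --glue-decl-name LieIrreducibleAutomorphy_of_resplit` lands (the children `SpecialCellAutomorphy`,
`GenericModuliAutomorphy` and the glue item must exist in the route file).  Closes the generated glue item
`LieIrreducibleAutomorphy_of_resplit : SpecialCellAutomorphy → GenericModuliAutomorphy → SymmetricPowerTransport →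
HigherLieRankAutomorphy → LieIrreducibleAutomorphy`.  Pure logic: strong induction on the rank (the landed proof of glue
26926, `LieIrreducibleAutomorphy_of_split_proof`, verbatim for `n ≥ 3`); at `n = 2` excluded middle on the inlined
TR/CM-type dial selects the special or the generic cell.  Certified beforehand on the mock render
`ModuliFieldDichotomy.kit_check.lean` (rc 0 · 0 sorry · axioms standard).  No definitions, no new mathematics.
-/

set_option linter.dupNamespace false

namespace Summit.Langlands.Langlands.Theorems

open Summit.Langlands.Langlands.Theses.MonodromyDichotomy in
/-- The glue item of the lens-2-g4 resplit of `LieIrreducibleAutomorphy` (stmt-Langlands-25617): the four children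
`SpecialCellAutomorphy`, `GenericModuliAutomorphy`, `SymmetricPowerTransport`, `HigherLieRankAutomorphy` imply the parent. -/
theorem LieIrreducibleAutomorphy_of_resplit_proof :
    Summit.Langlands.Langlands.Theses.MonodromyDichotomy.LieIrreducibleAutomorphy_of_resplit := by
  intro hSP hGE hSYM hH K _ _ n
  induction n using Nat.strong_induction_on generalizing K with
  | _ n ih =>
    intro hcpt hn ℓ _ ι ρ hirr hgeo hLie
    by_cases h3 : 3 ≤ n
    · exact (Classical.em _).elim
        (fun hPS => hSYM K n hcpt h3
          (fun m hm hmn E _ _ hE ℓ' _ ι' σ h₁ h₂ h₃ => ih m hmn E hE hm ℓ' ι' σ h₁ h₂ h₃)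
          ℓ ι ρ hirr hgeo hLie hPS)
        (fun hPS => hH K n hcpt h3
          (fun m hm hmn E _ _ hE ℓ' _ ι' σ h₁ h₂ h₃ => ih m hmn E hE hm ℓ' ι' σ h₁ h₂ h₃)
          ℓ ι ρ hirr hgeo hLie hPS)
    · obtain rfl : n = 2 := by omega
      exact (Classical.em _).elim (fun hsat => hSP K hcpt ℓ ι ρ hirr hgeo hLie hsat)
        (fun hsat => hGE K hcpt ℓ ι ρ hirr hgeo hLie hsat)

end Summit.Langlands.Langlands.Theorems
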